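import Summits.AtomisticToContinuum.HydrodynamicLimit.Theorems.StiffCollisionalRelaxationAprioriBoundsMesoPairDecorrelationGlue
import Summits.AtomisticToContinuum.HydrodynamicLimit.Theorems.StiffCollisionalRelaxationAprioriBoundsMesoVarianceTimeZeroBridge
import Summits.AtomisticToContinuum.HydrodynamicLimit.Theorems.OneSphereInfluenceStaticScoreResponseDisintegration
import HarnessLib

/-!
# The two consistency rungs of `FixedTimeTailVariance` (line `meso-chebyshev-window`, crux `AprioriBounds`,
# stmt-AtomisticToContinuum-14827): constant profiles at every time, and time zero for every nice profile

Supporting file (`--supports stmt-AtomisticToContinuum-14827`).  The (i)-half of the crux was reduced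
(`occupationVariance_of_fixedTimeTailVariance`, `…MesoPairDecorrelationDockTools`) to FIXED-TIME ONE-BODY
CONCENTRATION of the velocity-tail fraction `frac_K(w) = (N+1)⁻¹ #{i : K ≤ |vᵢ|²}` (`frac_eq_avg`): under the crux
prefix, for every level `K` and every `s ∈ [0, t]`, `Var_{P_N}(frac_K ∘ Φ^N_s) → 0`,
`P_N = localGibbsLaw σ a₀ u₀ θ₀ N (Φ N)`.  Two TRUE instances are kernel-checked here, for EVERY flow family:

* §1 THE HOMOGENEOUS RUNG (`fixedTimeTailVariance_homogeneous`): for CONSTANT profiles `(a, u₀, θ₀)`, `σ ≤ 1/2`,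
  every hard-sphere flow and EVERY time `s`, `Var_{P_N}(frac_K ∘ Φ_s) = Var_{P_N}(frac_K) ≤ 1/(4(N+1))`: the
  constant-profile law is invariant under every `Φ_s` (`measurePreserving_flow_localGibbsLaw_const`) and the static
  variance is `≤ 1/(4(N+1))` (`variance_frac_le_const`: i.i.d. Maxwellian velocities, Bienaymé, Popoviciu).
* §2–§4 THE TIME-ZERO RUNG (`fixedTimeTailVariance_timeZero`): for every continuous positive (INHOMOGENEOUS) profile
  there is `σ₀ > 0` (the low-density regime `exists_smallDensity (profileOf a₀)` of the canonical cluster expansion,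
  capped by `1/2`) such that for `0 < σ < σ₀`, every flow family and every `K`, `Var_{P_N}(frac_K ∘ Φ^N_0) → 0`.
  Proof: (a) `Φ_0 = id` a.s., so `Var(frac_K ∘ Φ_0) = Var(frac_K)` (`tzVar_measurePreserving_flow_zero`);
  (b) EXCHANGEABILITY of the row `gᵢ(z) = 𝟙{K ≤ |vᵢ|²}` under `P_N` (`EvenStressEnskog.integral_comp_perm_localGibbsLaw`,
  `variance_avg_of_perm_invariant`): `Var frac_K = (Var g₀ + N·Cov(g₀, g₁))/(N+1) ≤ 1/(4(N+1)) + |Cov(g₀, g₁)|`;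
  (c) CONDITIONALLY ON THE POSITIONS THE VELOCITIES ARE INDEPENDENT MAXWELLIANS `N(u₀(qᵢ), θ₀(qᵢ))`
  (`localGibbsMeasure_eq_map` / `integral_localGibbsMeasure_eq`, §2): `E[g₀] = E_pos[p(q₀)]`,
  `E[g₀ g₁] = E_pos[p(q₀) p(q₁)]` with the Maxwellian tail probability
  `p(y) = ∫ 𝟙{K ≤ |u₀(y) + √θ₀(y) w|²} dγ(w) = N(u₀(y), θ₀(y)){K ≤ |v|²} ∈ [0, 1]`, measurable in `y`; in the
  cluster-expansion normalisation these are the one- and two-point expectations `onePt`, `twoPt` of the canonical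
  gas `posGibbsMeasure a₀ ε_N (N+1)` (§3); (d) the one- and two-point LIMITS of `HardSphereEulerLLN`
  (`SmallDensity.tendsto_onePt`, `SmallDensity.tendsto_twoPt`, bounded measurable kernel `p`):
  `Cov(g₀, g₁) = E_{N+1}[p(x₀)p(x₁)] − E_{N+1}[p(x₀)]² → I(p)² − I(p)² = 0`.

No new definitions, no named facts; axioms `propext`, `Classical.choice`, `Quot.sound`.  References: H. Spohn,
*Large Scale Dynamics of Interacting Particles* (1991), Part I §2.3; E. Pulvirenti, D. Tsagkarogiannis, Comm. Math.
Phys. 316 (2012) 289–306.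
-/

noncomputable section

open MeasureTheory ProbabilityTheory Filter Set Topology
open scoped ENNReal

namespace Summit.AtomisticToContinuum.HydrodynamicLimit.Theorems.MesoChebyshevWindow

open Literature.MathematicalPhysics.KineticTheory Literature.Analysis.FluidPDE
open Literature.MathematicalPhysics.StatisticalMechanics Literature.Probability.LatticeModels
open Summit.AtomisticToContinuum.HydrodynamicLimit.Theorems.VisitLedgerUpscattering (Cfg Flow Flows NiceProfiles)
open Summit.AtomisticToContinuum.HydrodynamicLimit.Theorems.FibreDeficitTransfer

/-! ## §1 The homogeneous rung: constant profiles, every time, every flow -/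

/-- **`Var_{P_N}(frac_K ∘ Φ_s) ≤ 1/(4(N+1))` AT CONSTANT PROFILES, EVERY FLOW, EVERY TIME.**  For `σ ≤ 1/2`,
`a, θ₀ > 0`, any `u₀`, every `N`, every hard-sphere flow `Φ` of `N + 1` spheres, every time `s` and every level `K`:
the constant-profile local Gibbs law is invariant under `Φ_s` (`measurePreserving_flow_localGibbsLaw_const`), so the
variance of `frac_K ∘ Φ_s` is the static one, `≤ 1/(4(N+1))` (`variance_frac_le_const`). -/
theorem variance_frac_flow_le_const {σ a θ₀ : ℝ} (u₀ : V3) (hσ2 : σ ≤ 1 / 2) (ha : 0 < a) (hθ : 0 < θ₀) (N : ℕ)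
    (Φ : HardSphereFlow (Torus.geometry (Fin 3)) (hsDiameter σ N) (N + 1)) (s K : ℝ) :
    variance (fun z => frac K (Φ.flow s z)) (localGibbsLaw σ (fun _ => a) (fun _ => u₀) (fun _ => θ₀) N Φ) ≤
      1 / (4 * ((N + 1 : ℕ) : ℝ)) := by
  rw [(measurePreserving_flow_localGibbsLaw_const σ a θ₀ u₀ N Φ s).variance_fun_comp
    (measurable_frac K).aemeasurable]
  exact variance_frac_le_const u₀ hσ2 ha hθ N Φ K

/-- `1/(4(N+1)) → 0`. -/
theorem tendsto_one_div_four_mul_succ : Tendsto (fun N : ℕ => 1 / (4 * ((N + 1 : ℕ) : ℝ))) atTop (𝓝 0) := by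
  have h := (tendsto_const_div_atTop_nhds_zero_nat (1 / 4 : ℝ)).comp (tendsto_add_atTop_nat 1)
  refine h.congr fun N => ?_
  simp only [Function.comp_apply]
  rw [div_div]

/-- **THE HOMOGENEOUS RUNG of `FixedTimeTailVariance`** (registered helper of the line `meso-chebyshev-window`): for
CONSTANT profiles `(a₀, u₀, θ₀) ≡ (a, u₀, θ₀)` with `a, θ₀ > 0` and `0 < σ ≤ 1/2`, for EVERY flow family, EVERY time
`s` and every level `K`, `Var_{P_N}(frac_K ∘ Φ^N_s) → 0` (indeed `≤ 1/(4(N+1))`, `variance_frac_flow_le_const`). -/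
theorem fixedTimeTailVariance_homogeneous : ∀ (σ a θ₀ : ℝ) (u₀ : V3), 0 < σ → σ ≤ 1 / 2 → 0 < a → 0 < θ₀ → ∀ (Φ : (N : ℕ) → HardSphereFlow (Torus.geometry (Fin 3)) (hsDiameter σ N) (N + 1)) (s K : ℝ), Tendsto (fun N : ℕ => variance (fun z => frac K ((Φ N).flow s z)) (localGibbsLaw σ (fun _ => a) (fun _ => u₀) (fun _ => θ₀) N (Φ N))) atTop (𝓝 0) :=
  fun _σ _a _θ₀ u₀ _ hσ2 ha hθ Φ s K =>
    squeeze_zero (fun _ => variance_nonneg _ _) (fun N => variance_frac_flow_le_const u₀ hσ2 ha hθ N (Φ N) s K)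
      tendsto_one_div_four_mul_succ

/-! ## §2 Integrating out the conditionally Maxwellian velocities of one or two tagged spheres -/

variable {a₀ θ₀ : T3 → ℝ} {u₀ : T3 → V3}

/-- **One tagged velocity.**  For continuous profiles (`a₀ ≥ 0`, `θ₀ > 0`), a bounded measurable `g : ℝ³ → ℝ` and a
label `i`: `∫ g(vᵢ) dP_N = ∫ p_g(qᵢ) d(posGibbsMeasure a₀ ε_N (N+1))` with the Maxwellian average
`p_g(y) = ∫ g(u₀(y) + √θ₀(y) w) dγ(w)` — the local Gibbs measure in Gaussian coordinates
(`integral_localGibbsMeasure_eq`) and the `i`-th marginal of `γ^{⊗(N+1)}` (`integral_comp_eval`). -/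
theorem ftv_integral_oneBody_vel (ha : Continuous a₀) (hθ : Continuous θ₀) (hu : Continuous u₀)
    (ha0 : ∀ x, 0 ≤ a₀ x) (hθ0 : ∀ x, 0 < θ₀ x) (σ : ℝ) (N : ℕ) [IsFiniteMeasure (localGibbsMeasure σ a₀ u₀ θ₀ N)]
    {g : V3 → ℝ} (hg : Measurable g) {C : ℝ} (hgC : ∀ v, |g v| ≤ C) (i : Fin (N + 1)) :
    ∫ z, g (z i).2 ∂localGibbsMeasure σ a₀ u₀ θ₀ N =
      ∫ q, (∫ w, g (u₀ (q i) + Real.sqrt (θ₀ (q i)) • w) ∂stdGaussian V3)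
        ∂posGibbsMeasure a₀ (hsDiameter σ N) (N + 1) := by
  have hGm : Measurable fun z : Config (N + 1) (Fin 3) T3 => g (z i).2 := hg.comp (measurable_pi_apply i).snd
  have hGi : Integrable (fun z : Config (N + 1) (Fin 3) T3 => g (z i).2) (localGibbsMeasure σ a₀ u₀ θ₀ N) :=
    (memLp_of_bounded (a := -C) (b := C) (ae_of_all _ fun z => abs_le.1 (hgC _)) hGm.aestronglyMeasurable
      1).integrable le_rfl
  rw [integral_localGibbsMeasure_eq ha hθ hu ha0 hθ0 σ N hGi]
  refine integral_congr_ae (ae_of_all _ fun q => ?_)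
  simp only [zipConfig_apply]
  exact integral_comp_eval (μ := fun _ : Fin (N + 1) => stdGaussian V3)
    (f := fun v => g (u₀ (q i) + Real.sqrt (θ₀ (q i)) • v)) (hg.comp (measurable_gaussShift _ _)).aestronglyMeasurable

/-- **Two distinct tagged velocities.**  For continuous profiles (`a₀ ≥ 0`, `θ₀ > 0`), bounded measurable
`g, g' : ℝ³ → ℝ` and labels `i ≠ j`: `∫ g(vᵢ) g'(vⱼ) dP_N = ∫ p_g(qᵢ) p_{g'}(qⱼ) d(posGibbsMeasure a₀ ε_N (N+1))` —
conditionally on the positions the velocities are INDEPENDENT Maxwellians (`integral_localGibbsMeasure_eq`, then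
independence of the coordinates `i ≠ j` of `γ^{⊗(N+1)}`, `iIndepFun_pi`). -/
theorem ftv_integral_twoBody_vel (ha : Continuous a₀) (hθ : Continuous θ₀) (hu : Continuous u₀)
    (ha0 : ∀ x, 0 ≤ a₀ x) (hθ0 : ∀ x, 0 < θ₀ x) (σ : ℝ) (N : ℕ) [IsFiniteMeasure (localGibbsMeasure σ a₀ u₀ θ₀ N)]
    {g g' : V3 → ℝ} (hg : Measurable g) (hg' : Measurable g') {C C' : ℝ} (hgC : ∀ v, |g v| ≤ C)
    (hgC' : ∀ v, |g' v| ≤ C') {i j : Fin (N + 1)} (hij : i ≠ j) :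
    ∫ z, g (z i).2 * g' (z j).2 ∂localGibbsMeasure σ a₀ u₀ θ₀ N =
      ∫ q, (∫ w, g (u₀ (q i) + Real.sqrt (θ₀ (q i)) • w) ∂stdGaussian V3) *
          (∫ w, g' (u₀ (q j) + Real.sqrt (θ₀ (q j)) • w) ∂stdGaussian V3)
        ∂posGibbsMeasure a₀ (hsDiameter σ N) (N + 1) := by
  have hC : 0 ≤ C := (abs_nonneg _).trans (hgC 0)
  have hGm : Measurable fun z : Config (N + 1) (Fin 3) T3 => g (z i).2 * g' (z j).2 :=
    (hg.comp (measurable_pi_apply i).snd).mul (hg'.comp (measurable_pi_apply j).snd)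
  have hGb : ∀ z : Config (N + 1) (Fin 3) T3, |g (z i).2 * g' (z j).2| ≤ C * C' := fun z => by
    rw [abs_mul]
    exact mul_le_mul (hgC _) (hgC' _) (abs_nonneg _) hC
  have hGi : Integrable (fun z : Config (N + 1) (Fin 3) T3 => g (z i).2 * g' (z j).2)
      (localGibbsMeasure σ a₀ u₀ θ₀ N) :=
    (memLp_of_bounded (a := -(C * C')) (b := C * C') (ae_of_all _ fun z => abs_le.1 (hGb z))
      hGm.aestronglyMeasurable 1).integrable le_rfl
  rw [integral_localGibbsMeasure_eq ha hθ hu ha0 hθ0 σ N hGi]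
  refine integral_congr_ae (ae_of_all _ fun q => ?_)
  simp only [zipConfig_apply]
  -- independence of the coordinates `i ≠ j` under `γ^{⊗(N+1)}` (adapted from
  -- `integral_comp_eval_mul_comp_eval_gaussPi` of `…OneSphereInfluenceStaticScoreResponseGaussPi`)
  have hFm : Measurable fun v : V3 => g (u₀ (q i) + Real.sqrt (θ₀ (q i)) • v) :=
    hg.comp (measurable_gaussShift _ _)
  have hGm' : Measurable fun v : V3 => g' (u₀ (q j) + Real.sqrt (θ₀ (q j)) • v) :=
    hg'.comp (measurable_gaussShift _ _)
  have h0 : iIndepFun (fun k (w : Fin (N + 1) → V3) => w k) (Measure.pi fun _ : Fin (N + 1) => stdGaussian V3) :=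
    iIndepFun_pi (X := fun _ => id) fun _ => aemeasurable_id
  have h2 : IndepFun (fun w : Fin (N + 1) → V3 => g (u₀ (q i) + Real.sqrt (θ₀ (q i)) • w i))
      (fun w : Fin (N + 1) → V3 => g' (u₀ (q j) + Real.sqrt (θ₀ (q j)) • w j))
      (Measure.pi fun _ : Fin (N + 1) => stdGaussian V3) := (h0.indepFun hij).comp hFm hGm'
  rw [h2.integral_fun_mul_eq_mul_integral (hFm.comp (measurable_pi_apply i)).aestronglyMeasurable
      (hGm'.comp (measurable_pi_apply j)).aestronglyMeasurable]
  congr 1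
  · exact integral_comp_eval (μ := fun _ : Fin (N + 1) => stdGaussian V3)
      (f := fun v => g (u₀ (q i) + Real.sqrt (θ₀ (q i)) • v)) hFm.aestronglyMeasurable
  · exact integral_comp_eval (μ := fun _ : Fin (N + 1) => stdGaussian V3)
      (f := fun v => g' (u₀ (q j) + Real.sqrt (θ₀ (q j)) • v)) hGm'.aestronglyMeasurable

/-- The Maxwellian average `y ↦ ∫ g(u₀(y) + √θ₀(y) w) dγ(w)` of a measurable `g` is measurable for continuous
`u₀, θ₀` (Fubini measurability, `StronglyMeasurable.integral_prod_right'`). -/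
theorem ftv_measurable_velAverage (hθ : Continuous θ₀) (hu : Continuous u₀) {g : V3 → ℝ} (hg : Measurable g) :
    Measurable fun y : T3 => ∫ w, g (u₀ y + Real.sqrt (θ₀ y) • w) ∂stdGaussian V3 := by
  have hm : Measurable fun p : T3 × V3 => g (u₀ p.1 + Real.sqrt (θ₀ p.1) • p.2) :=
    hg.comp ((hu.measurable.comp measurable_fst).add
      ((Real.continuous_sqrt.measurable.comp (hθ.measurable.comp measurable_fst)).smul measurable_snd))
  exact (hm.stronglyMeasurable.integral_prod_right' (ν := stdGaussian V3)).measurable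

/-- The Maxwellian average of `g` with `|g| ≤ C` is bounded by `C` (`γ` is a probability measure). -/
theorem ftv_abs_velAverage_le (u₀ : T3 → V3) (θ₀ : T3 → ℝ) {g : V3 → ℝ} {C : ℝ} (hgC : ∀ v, |g v| ≤ C) (y : T3) :
    |∫ w, g (u₀ y + Real.sqrt (θ₀ y) • w) ∂stdGaussian V3| ≤ C := by
  have h := norm_integral_le_of_norm_le_const (μ := stdGaussian V3)
    (f := fun w => g (u₀ y + Real.sqrt (θ₀ y) • w)) (C := C) (ae_of_all _ fun w => by
      rw [Real.norm_eq_abs]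
      exact hgC _)
  rwa [Real.norm_eq_abs, probReal_univ, mul_one] at h

/-! ## §3 One- and two-point expectations of the canonical gas -/

/-- `∫ χ(qᵢ) d(posGibbsMeasure a₀ ε_N (N+1)) = onePt (profileOf a₀) σ χ N 0 = E_{N+1}[χ(x₀)]` for every label `i`
(cluster-expansion normalisation `LGFS.integral_posGibbs_eq` and one marked particle `integral_mul_efR_eq_Md`). -/
theorem ftv_integral_apply_posGibbs_eq_onePt (ha : Continuous a₀) (ha0 : ∀ x, 0 < a₀ x) (σ : ℝ) (N : ℕ)
    {χ : T3 → ℝ} (hχ : Measurable χ) (i : Fin (N + 1)) :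
    ∫ q, χ (q i) ∂posGibbsMeasure a₀ (hsDiameter σ N) (N + 1) = onePt (profileOf a₀ ha ha0) σ χ N 0 := by
  rw [LGFS.integral_posGibbs_eq ha ha0 σ N, integral_mul_efR_eq_Md _ _ hχ i, onePt, Nat.sub_zero, inv_mul_eq_div]

/-- `∫ χ(q₀) χ(q₁) d(posGibbsMeasure a₀ ε_N (N+1)) = twoPt (profileOf a₀) σ χ N = E_{N+1}[χ(x₀)χ(x₁)]` for `N ≥ 1`
(`LGFS.integral_posGibbs_eq`). -/
theorem ftv_integral_apply_zero_mul_one_posGibbs_eq_twoPt (ha : Continuous a₀) (ha0 : ∀ x, 0 < a₀ x) (σ : ℝ)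
    {N : ℕ} (hN : 1 ≤ N) (χ : T3 → ℝ) :
    ∫ q, χ (q 0) * χ (q 1) ∂posGibbsMeasure a₀ (hsDiameter σ N) (N + 1) = twoPt (profileOf a₀ ha ha0) σ χ N := by
  have h2 : 2 ≤ N + 1 := by omega
  have h1 : (⟨1, h2⟩ : Fin (N + 1)) = 1 := Fin.ext (by rw [Fin.val_one', Nat.mod_eq_of_lt (by omega)])
  rw [twoPt, dif_pos h2, h1, LGFS.integral_posGibbs_eq ha ha0 σ N, inv_mul_eq_div]

/-! ## §4 The time-zero rung for every nice profile -/

/-- **Variance of the average of a one-body velocity observable at time zero, general profiles.**  For continuous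
positive profiles, `σ ≤ 1/2`, `N ≥ 1`, any hard-sphere flow `Φ` and a measurable `g : ℝ³ → [0, 1]`, with the
Maxwellian average `p(y) = ∫ g(u₀(y) + √θ₀(y) w) dγ(w)`:
`Var_{P_N}((N+1)⁻¹ ∑ᵢ g(vᵢ(0))) ≤ 1/(4(N+1)) + |twoPt (profileOf a₀) σ p N − (onePt (profileOf a₀) σ p N 0)²|`.
Steps: `Φ_0 = id` a.s. (`tzVar_measurePreserving_flow_zero`); Bienaymé for the exchangeable row `g(vᵢ)`
(`variance_avg_of_perm_invariant`, `EvenStressEnskog.integral_comp_perm_localGibbsLaw`) and Popoviciu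
(`le_of_avg_identity`); `Cov(g(v₀), g(v₁)) = twoPt − onePt²` by §2–§3. -/
theorem ftv_variance_avg_flow_zero_le (ha : Continuous a₀) (hθ : Continuous θ₀) (hu : Continuous u₀)
    (ha0 : ∀ x, 0 < a₀ x) (hθ0 : ∀ x, 0 < θ₀ x) {σ : ℝ} (hσ2 : σ ≤ 1 / 2) {N : ℕ} (hN : 1 ≤ N)
    (Φ : HardSphereFlow (Torus.geometry (Fin 3)) (hsDiameter σ N) (N + 1)) {g : V3 → ℝ} (hg : Measurable g)
    (hg01 : ∀ v, g v ∈ Icc (0 : ℝ) 1) :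
    variance (fun z => ((N + 1 : ℕ) : ℝ)⁻¹ * ∑ i, g (Φ.flow 0 z i).2) (localGibbsLaw σ a₀ u₀ θ₀ N Φ) ≤
      1 / (4 * ((N + 1 : ℕ) : ℝ)) +
        |twoPt (profileOf a₀ ha ha0) σ (fun y => ∫ w, g (u₀ y + Real.sqrt (θ₀ y) • w) ∂stdGaussian V3) N -
          onePt (profileOf a₀ ha ha0) σ (fun y => ∫ w, g (u₀ y + Real.sqrt (θ₀ y) • w) ∂stdGaussian V3) N 0 *
            onePt (profileOf a₀ ha ha0) σ (fun y => ∫ w, g (u₀ y + Real.sqrt (θ₀ y) • w) ∂stdGaussian V3) N 0| := by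
  set P := profileOf a₀ ha ha0 with hP
  set p : T3 → ℝ := fun y => ∫ w, g (u₀ y + Real.sqrt (θ₀ y) • w) ∂stdGaussian V3 with hp
  haveI : IsProbabilityMeasure (localGibbsLaw σ a₀ u₀ θ₀ N Φ) :=
    isProbabilityMeasure_localGibbsLaw ha hθ hu ha0 hθ0 hσ2 N Φ
  haveI : IsProbabilityMeasure (localGibbsMeasure σ a₀ u₀ θ₀ N) :=
    isProbabilityMeasure_localGibbsMeasure ha hθ hu ha0 hθ0 hσ2 N
  haveI : NeZero N := ⟨by omega⟩
  have hgC : ∀ v, |g v| ≤ 1 := fun v => abs_le.2 ⟨by linarith [(hg01 v).1], (hg01 v).2⟩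
  have hpm : Measurable p := ftv_measurable_velAverage hθ hu hg
  -- the row `X i z = g (z i).2`
  have hXm : ∀ i : Fin (N + 1), Measurable fun z : Cfg N => g (z i).2 := fun i =>
    hg.comp (measurable_pi_apply i).snd
  have hX2 : ∀ i : Fin (N + 1), MemLp (fun z : Cfg N => g (z i).2) 2 (localGibbsLaw σ a₀ u₀ θ₀ N Φ) := fun i =>
    memLp_of_bounded (ae_of_all _ fun z : Cfg N => hg01 (z i).2) (hXm i).aestronglyMeasurable 2
  -- (a) time zero: the flow is the identity almost surely
  have h1 : variance (fun z => ((N + 1 : ℕ) : ℝ)⁻¹ * ∑ i, g (Φ.flow 0 z i).2) (localGibbsLaw σ a₀ u₀ θ₀ N Φ) =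
      variance (fun z : Cfg N => ((N + 1 : ℕ) : ℝ)⁻¹ * ∑ i, g (z i).2) (localGibbsLaw σ a₀ u₀ θ₀ N Φ) :=
    (tzVar_measurePreserving_flow_zero σ a₀ u₀ θ₀ N Φ).variance_fun_comp
      (f := fun z : Cfg N => ((N + 1 : ℕ) : ℝ)⁻¹ * ∑ i, g (z i).2)
      (measurable_const.mul (Finset.measurable_sum _ fun i _ => hXm i)).aemeasurable
  -- (b) Bienaymé for the exchangeable row
  have hex : ∀ (π : Equiv.Perm (Fin (N + 1))) (G : (Fin (N + 1) → ℝ) → ℝ),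
      ∫ z, G (fun k => g (z (π k)).2) ∂(localGibbsLaw σ a₀ u₀ θ₀ N Φ) =
        ∫ z, G (fun k => g (z k).2) ∂(localGibbsLaw σ a₀ u₀ θ₀ N Φ) := fun π G =>
    EvenStressEnskog.integral_comp_perm_localGibbsLaw σ a₀ θ₀ u₀ N Φ π fun z => G fun k => g (z k).2
  have hid : Var[fun z : Cfg N => ((N + 1 : ℕ) : ℝ)⁻¹ * ∑ i, g (z i).2; localGibbsLaw σ a₀ u₀ θ₀ N Φ] =
      (Var[fun z : Cfg N => g (z 0).2; localGibbsLaw σ a₀ u₀ θ₀ N Φ] +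
        (N : ℝ) * cov[fun z : Cfg N => g (z 0).2, fun z : Cfg N => g (z 1).2; localGibbsLaw σ a₀ u₀ θ₀ N Φ]) /
        ((N + 1 : ℕ) : ℝ) :=
    variance_avg_of_perm_invariant (X := fun i (z : Cfg N) => g (z i).2) hX2 hex
  have hV : Var[fun z : Cfg N => g (z 0).2; localGibbsLaw σ a₀ u₀ θ₀ N Φ] ≤ (1 : ℝ) ^ 2 / 4 :=
    (variance_le_sq_of_bounded (ae_of_all _ fun z : Cfg N => hg01 (z 0).2) (hXm 0).aemeasurable).trans_eq (by norm_num)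
  have hle := le_of_avg_identity hid hV
  -- (c) the moments of two tagged spheres through the positions
  have e2 : ∫ z, g (z 0).2 * g (z 1).2 ∂(localGibbsLaw σ a₀ u₀ θ₀ N Φ) = twoPt P σ p N := by
    rw [localGibbsLaw_eq, ftv_integral_twoBody_vel ha hθ hu (fun x => (ha0 x).le) hθ0 σ N hg hg hgC hgC
      Fin.zero_ne_one']
    exact ftv_integral_apply_zero_mul_one_posGibbs_eq_twoPt ha ha0 σ hN p
  have e1 : ∀ i : Fin (N + 1), ∫ z, g (z i).2 ∂(localGibbsLaw σ a₀ u₀ θ₀ N Φ) = onePt P σ p N 0 := fun i => by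
    rw [localGibbsLaw_eq, ftv_integral_oneBody_vel ha hθ hu (fun x => (ha0 x).le) hθ0 σ N hg hgC i]
    exact ftv_integral_apply_posGibbs_eq_onePt ha ha0 σ N hpm i
  have hcov : cov[fun z : Cfg N => g (z 0).2, fun z : Cfg N => g (z 1).2; localGibbsLaw σ a₀ u₀ θ₀ N Φ] =
      twoPt P σ p N - onePt P σ p N 0 * onePt P σ p N 0 := by
    rw [covariance_eq_sub (hX2 0) (hX2 1)]
    congr 1  -- the first summand `E[g(v₀) g(v₁)] = twoPt` is closed by `e2`
    rw [e1 0, e1 1]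
  rw [h1]
  calc Var[fun z : Cfg N => ((N + 1 : ℕ) : ℝ)⁻¹ * ∑ i, g (z i).2; localGibbsLaw σ a₀ u₀ θ₀ N Φ]
      ≤ (1 : ℝ) ^ 2 / (4 * ((N + 1 : ℕ) : ℝ)) +
          |cov[fun z : Cfg N => g (z 0).2, fun z : Cfg N => g (z 1).2; localGibbsLaw σ a₀ u₀ θ₀ N Φ]| := hle
    _ = 1 / (4 * ((N + 1 : ℕ) : ℝ)) + |twoPt P σ p N - onePt P σ p N 0 * onePt P σ p N 0| := by
        rw [one_pow, hcov]

/-- **THE TIME-ZERO RUNG of `FixedTimeTailVariance`, FOR EVERY NICE (INHOMOGENEOUS) PROFILE AND EVERY FLOW FAMILY**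
(registered helper of the line `meso-chebyshev-window`).  There is `σ₀ > 0` (`exists_smallDensity (profileOf a₀)`
capped by `1/2`) such that for `0 < σ < σ₀`, every flow family and every level `K`,
`Var_{P_N}(frac_K ∘ Φ^N_0) → 0`: by `ftv_variance_avg_flow_zero_le` (with `g = 𝟙{K ≤ |v|²}`, `frac_eq_avg`) the
variance is at most `1/(4(N+1)) + |E_{N+1}[p(x₀)p(x₁)] − E_{N+1}[p(x₀)]²|` for the measurable Maxwellian tail
probability `p ∈ [0, 1]`, and the one- and two-point limits of the canonical cluster expansion
(`SmallDensity.tendsto_onePt`, `SmallDensity.tendsto_twoPt`) send the truncated two-point function to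
`I(p)² − I(p)² = 0`. -/
theorem fixedTimeTailVariance_timeZero : ∀ (a₀ θ₀ : T3 → ℝ) (u₀ : T3 → V3), Continuous a₀ → Continuous θ₀ → Continuous u₀ → (∀ x, 0 < a₀ x) → (∀ x, 0 < θ₀ x) → ∃ σ₀ : ℝ, 0 < σ₀ ∧ ∀ σ : ℝ, 0 < σ → σ < σ₀ → ∀ (Φ : (N : ℕ) → HardSphereFlow (Torus.geometry (Fin 3)) (hsDiameter σ N) (N + 1)) (K : ℝ), Tendsto (fun N : ℕ => variance (fun z => frac K ((Φ N).flow 0 z)) (localGibbsLaw σ a₀ u₀ θ₀ N (Φ N))) atTop (𝓝 0) := by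
  intro a₀ θ₀ u₀ ha hθ hu ha0 hθ0
  obtain ⟨σ₁, hσ₁, hsd⟩ := exists_smallDensity (profileOf a₀ ha ha0) one_pos
  refine ⟨min σ₁ (1 / 2), lt_min hσ₁ one_half_pos, fun σ hσ hσlt Φ K => ?_⟩
  have hs : SmallDensity (profileOf a₀ ha ha0) σ := (hsd σ hσ (hσlt.trans_le (min_le_left _ _))).1
  have hσ2 : σ ≤ 1 / 2 := (hσlt.trans_le (min_le_right _ _)).le
  set P := profileOf a₀ ha ha0 with hP
  -- the velocity-tail indicator and its Maxwellian average
  set gK : V3 → ℝ := fun v => if K ≤ ‖v‖ ^ 2 then (1 : ℝ) else 0 with hgK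
  have hgKm : Measurable gK :=
    Measurable.ite (measurableSet_le measurable_const (measurable_norm.pow_const 2)) measurable_const
      measurable_const
  have hgK01 : ∀ v, gK v ∈ Icc (0 : ℝ) 1 := fun v => by
    simp only [hgK]
    split_ifs <;> norm_num
  have hgK1 : ∀ v, |gK v| ≤ 1 := fun v => abs_le.2 ⟨by linarith [(hgK01 v).1], (hgK01 v).2⟩
  set p : T3 → ℝ := fun y => ∫ w, gK (u₀ y + Real.sqrt (θ₀ y) • w) ∂stdGaussian V3 with hp
  have hpm : Measurable p := ftv_measurable_velAverage hθ hu hgKm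
  have hpC : ∀ y, |p y| ≤ 1 := fun y => ftv_abs_velAverage_le u₀ θ₀ hgK1 y
  -- the per-`N` bound (`N ≥ 1`)
  have hb : ∀ N : ℕ, 1 ≤ N → variance (fun z => frac K ((Φ N).flow 0 z)) (localGibbsLaw σ a₀ u₀ θ₀ N (Φ N)) ≤
      1 / (4 * ((N + 1 : ℕ) : ℝ)) + |twoPt P σ p N - onePt P σ p N 0 * onePt P σ p N 0| := by
    intro N hN
    have hfun : (fun z => frac K ((Φ N).flow 0 z)) =
        fun z => ((N + 1 : ℕ) : ℝ)⁻¹ * ∑ i, gK ((Φ N).flow 0 z i).2 := funext fun z => frac_eq_avg K _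
    rw [hfun]
    exact ftv_variance_avg_flow_zero_le ha hθ hu ha0 hθ0 hσ2 hN (Φ N) hgKm hgK01
  -- (d) the one- and two-point limits
  have h1pt := hs.tendsto_onePt hpm hpC 0
  have h2pt := hs.tendsto_twoPt hpm hpC
  have hcov : Tendsto (fun N => |twoPt P σ p N - onePt P σ p N 0 * onePt P σ p N 0|) atTop (𝓝 0) := by
    have h := (h2pt.sub (h1pt.mul h1pt)).abs
    have hz : |Ilim P σ p ^ 2 - Ilim P σ p * Ilim P σ p| = 0 := by rw [sq, sub_self, abs_zero]
    rwa [hz] at h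
  have hlim := tendsto_one_div_four_mul_succ.add hcov
  rw [add_zero] at hlim
  refine squeeze_zero' (Eventually.of_forall fun _ => variance_nonneg _ _) ?_ hlim
  filter_upwards [eventually_ge_atTop 1] with N hN using hb N hN

end Summit.AtomisticToContinuum.HydrodynamicLimit.Theorems.MesoChebyshevWindow

end
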